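import Summits.AtomisticToContinuum.BoseEinsteinCondensation.Theses.BECIroning

/-!
# AtomisticToContinuum / BoseEinsteinCondensation — route `BECIroning`, assembly

Settles the assembly item `stmt-AtomisticToContinuum-11431` of route
`route-AtomisticToContinuum-BECIroning`: the implication

  `IroningShellBound → ShellModeCounting → BoundaryTransferWeak → BoseEinsteinCondensation`

(the audited sub-problem abbrev `_root_.BoseEinsteinCondensation`, by name).

The hypotheses of `Assembly` are, verbatim and in the same order, those of the route's deciding
theorem `closes`, so the assembly is that composition, spelled out per potential `v`: the ironed
shell bound `IroningShellBound` gives its body for a repulsive finite-range `v`; the support item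
`ShellModeCounting` turns that body into constant-mode condensation `≥ c N` for near-minimisers on
the torus (the periodic-BEC body); the crux `BoundaryTransferWeak` carries torus condensation to
Dirichlet ground-state BEC `∃ ρ₀ > 0, ∀ ρ ∈ (0, ρ₀), HasGroundStateBEC v ρ`, which is the conjunct
`BoseEinsteinCondensation` at `v`. Pure logic; no analytic content lives here.

References: [LSSY2005, §1.2 and Ch. 5] (the conjunct being assembled),
[KennedyLiebShastry1988] (the mode-counting shape behind `ShellModeCounting`).
-/

namespace Summit.AtomisticToContinuum.BoseEinsteinCondensation.Theorems

/-- **Item stmt-AtomisticToContinuum-11431** (`Assembly` of route `BECIroning`, exact route decl):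
given `h1 : IroningShellBound`, `h2 : ShellModeCounting` and `h3 : BoundaryTransferWeak`, for every
repulsive finite-range radial `v` the term `h3 v hv (h2 v hv (h1 v hv))` is
`∃ ρ₀ > 0, ∀ ρ ∈ (0, ρ₀), HasGroundStateBEC v ρ`, i.e. the conjunct `BoseEinsteinCondensation` at `v`.
Pure composition of the route's hypotheses (the route's deciding theorem `closes`, curried).
[folklore] -/
theorem becIroning_assembly_proof :
    Summit.AtomisticToContinuum.BoseEinsteinCondensation.Theses.BECIroning.Assembly := by
  unfold Theses.BECIroning.Assembly
  intro h1 h2 h3 v hv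
  exact h3 v hv (h2 v hv (h1 v hv))

end Summit.AtomisticToContinuum.BoseEinsteinCondensation.Theorems
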